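import Summits.NavierStokesRegularity.FluidComputer.RowSegment
import Mathlib.Analysis.Calculus.LocalExtr.Rolle
import HarnessLib

/-!
# `RowPhaseMap`: the phase-map hypotheses of `RowModel.MemberOn` DISCHARGED by the inverse-function
# construction of `Reparam` (layer A′ of `pub-fluidc-bp3/R1-DESIGN.md` §8.5 / §11.6, local part)

HONEST FRAMING (cell `pub-fluidc`, blueprint seat bp3, gen 22): low prior, high value-of-information
experiment on Tao's machine paradigm; NOT a claim that NS blows up. One-variable real analysis over an
abstract `RowModel`; nothing here mentions a fluid.

WHY. `RowModel.MemberOn Ts` bundles six hypotheses on a member of a row; four of them — the phase map `s`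
is continuous on `[T₀, Ts]` (`hsc`), has right derivative `sd` (`hsd`), maps into the ODE domain (`hsD`) and
locks the phase `y_p(s t) = x̂_p(t)` (`hlock`) — are not assumptions about the circuit but consequences of a
CONSTRUCTION: on a parameter window `[a, b] ⊆ D` on which `ψ := ε·y_p` (`ε = ±1`) is continuous and
strictly increasing, and as long as the reference coordinate `ε·x̂_p(t)` stays in the open range
`(ψ a, ψ b)`, the phase map IS `s := ψ⁻¹ ∘ (ε·x̂_p)` (`Reparam.inv`) and its right derivative IS
`x̂'_p(t) / ẏ_p(s t)`.  `phaseLock_of_reparam` proves the four fields from that description;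
`memberOn_of_reparam` packages them with the two genuine hypotheses (the ODE with defect, the defect
class) into a `MemberOn Ts` record, and `RowData.memberOn_row` is its specialisation to a row of the chain
(`toModel (canon h) G T0 m`: the reference `x̂ = xh r.CQ (· − T0)` is a polynomial, so its continuity and
derivative come for free from `hasDerivAt_xh`).  What remains for layer A′ proper is the RANGE condition along a stage
(a continuation argument: the boxes of `row_sound` keep `ẏ_p` sign-definite, so the window can be
re-chosen as the member advances) — not in this file.

[cite: Tao2016AveragedNS, §5.5 Thm 5.3 (5.5)]
-/

noncomputable section

open Set Filter Topology

namespace Summit.NavierStokesRegularity.FluidComputer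

namespace RowModel

variable {ι : Type*} {κ : Type*} [Fintype ι] [Fintype κ] (R : RowModel ι κ)

variable {R} in
omit [Fintype ι] [Fintype κ] in
/-- **Phase lock by reparametrisation.** On a window `[a, b] ⊆ D` where `ψ := ε·y_p` (`ε = ±1`) is
continuous and strictly increasing with `ẏ_p ≠ 0`, if the reference coordinate satisfies
`ε·x̂_p(t) ∈ (ψ a, ψ b)` on `[T₀, Ts]`, and the member's `s`, `sd` ARE `ψ⁻¹ ∘ (ε·x̂_p)` and
`x̂'_p / ẏ_p(s ·)` there, then `s` is continuous, right-differentiable with derivative `sd`, maps into `D`,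
and locks the phase. [folklore] -/
theorem phaseLock_of_reparam {Ts a b ε : ℝ} (hab : a ≤ b) (hε : ε = 1 ∨ ε = -1)
    (hψc : ContinuousOn (fun σ => ε * R.y σ R.p) (Icc a b))
    (hψm : StrictMonoOn (fun σ => ε * R.y σ R.p) (Icc a b)) (hD : Icc a b ⊆ R.D)
    (hy : ∀ σ ∈ R.D, ∀ i, HasDerivAt (fun r => R.y r i) (R.F (R.y σ) i + R.δF σ i) σ)
    (hne : ∀ σ ∈ Icc a b, R.F (R.y σ) R.p + R.δF σ R.p ≠ 0)
    (hxc : ContinuousOn (fun t => R.xh t R.p) (Icc R.T₀ Ts))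
    (hxd : ∀ t ∈ Ico R.T₀ Ts, HasDerivWithinAt (fun r => R.xh r R.p) (R.xh' t R.p) (Ici t) t)
    (hrange : ∀ t ∈ Icc R.T₀ Ts, ε * R.xh t R.p ∈ Ioo (ε * R.y a R.p) (ε * R.y b R.p))
    (hs : ∀ t ∈ Icc R.T₀ Ts, R.s t = Reparam.inv hab hψc hψm (ε * R.xh t R.p))
    (hsd : ∀ t ∈ Ico R.T₀ Ts, R.sd t = R.xh' t R.p / (R.F (R.y (R.s t)) R.p + R.δF (R.s t) R.p)) :
    ContinuousOn R.s (Icc R.T₀ Ts) ∧ (∀ t ∈ Ico R.T₀ Ts, HasDerivWithinAt R.s (R.sd t) (Ici t) t) ∧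
      (∀ t ∈ Icc R.T₀ Ts, R.s t ∈ R.D) ∧ (∀ t ∈ Icc R.T₀ Ts, R.y (R.s t) R.p = R.xh t R.p) := by
  have hε0 : ε ≠ 0 := by rcases hε with h | h <;> rw [h] <;> norm_num
  -- `s t ∈ (a, b)` on `[T₀, Ts]`
  have hsI : ∀ t ∈ Icc R.T₀ Ts, R.s t ∈ Ioo a b := fun t ht => by
    rw [hs t ht]; exact Reparam.inv_mem_Ioo hab hψc hψm (hrange t ht)
  refine ⟨?_, ?_, fun t ht => hD (Ioo_subset_Icc_self (hsI t ht)), ?_⟩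
  · -- continuity
    have hχ : ContinuousOn (fun t => ε * R.xh t R.p) (Icc R.T₀ Ts) := continuousOn_const.mul hxc
    exact (Reparam.reparam_continuousOn hab hψc hψm hχ).congr fun t ht => hs t ht
  · -- right derivative
    intro t ht
    have htc : t ∈ Icc R.T₀ Ts := Ico_subset_Icc_self ht
    have hσ := hsI t htc
    have hσD : R.s t ∈ R.D := hD (Ioo_subset_Icc_self hσ)
    have hψ' : HasDerivAt (fun σ => ε * R.y σ R.p) (ε * (R.F (R.y (R.s t)) R.p + R.δF (R.s t) R.p))
        (Reparam.inv hab hψc hψm (ε * R.xh t R.p)) := by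
      rw [← hs t htc]; exact (hy (R.s t) hσD R.p).const_mul ε
    have hne' : ε * (R.F (R.y (R.s t)) R.p + R.δF (R.s t) R.p) ≠ 0 :=
      mul_ne_zero hε0 (hne (R.s t) (Ioo_subset_Icc_self hσ))
    have h := Reparam.reparam_hasDerivWithinAt hab hψc hψm (χ := fun r => ε * R.xh r R.p) (t := t)
      (hrange t htc) ((hxd t ht).const_mul ε) hψ' hne'
    have hval : ε * R.xh' t R.p / (ε * (R.F (R.y (R.s t)) R.p + R.δF (R.s t) R.p)) = R.sd t := by
      rw [hsd t ht, mul_div_mul_left _ _ hε0]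
    rw [hval] at h
    refine h.congr_of_eventuallyEq ?_ (hs t htc)
    have hTs : Iio Ts ∈ 𝓝 t := Iio_mem_nhds ht.2
    filter_upwards [inter_mem_nhdsWithin (Ici t) hTs] with r hr
    exact hs r ⟨le_trans ht.1 hr.1, le_of_lt hr.2⟩
  · -- the lock
    intro t ht
    have h := Reparam.apply_inv hab hψc hψm (Ioo_subset_Icc_self (hrange t ht))
    rw [← hs t ht] at h
    exact mul_left_cancel₀ hε0 h

variable {R} in
omit [Fintype ι] [Fintype κ] in
/-- **`MemberOn` from the construction**: the two genuine hypotheses (the ODE with defect on `D`, the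
E-scaled defect class) plus the reparametrisation data of `phaseLock_of_reparam` give the member record
on `[T₀, Ts]`. [folklore] -/
def memberOn_of_reparam {Ts a b ε : ℝ} (hab : a ≤ b) (hε : ε = 1 ∨ ε = -1)
    (hψc : ContinuousOn (fun σ => ε * R.y σ R.p) (Icc a b))
    (hψm : StrictMonoOn (fun σ => ε * R.y σ R.p) (Icc a b)) (hD : Icc a b ⊆ R.D)
    (hy : ∀ σ ∈ R.D, ∀ i, HasDerivAt (fun r => R.y r i) (R.F (R.y σ) i + R.δF σ i) σ)
    (hne : ∀ σ ∈ Icc a b, R.F (R.y σ) R.p + R.δF σ R.p ≠ 0)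
    (hxc : ContinuousOn (fun t => R.xh t R.p) (Icc R.T₀ Ts))
    (hxd : ∀ t ∈ Ico R.T₀ Ts, HasDerivWithinAt (fun r => R.xh r R.p) (R.xh' t R.p) (Ici t) t)
    (hrange : ∀ t ∈ Icc R.T₀ Ts, ε * R.xh t R.p ∈ Ioo (ε * R.y a R.p) (ε * R.y b R.p))
    (hs : ∀ t ∈ Icc R.T₀ Ts, R.s t = Reparam.inv hab hψc hψm (ε * R.xh t R.p))
    (hsd : ∀ t ∈ Ico R.T₀ Ts, R.sd t = R.xh' t R.p / (R.F (R.y (R.s t)) R.p + R.δF (R.s t) R.p))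
    (hδ : ∀ t ∈ Icc R.T₀ Ts, (∀ a, |R.e t a| ≤ R.Ebar a) → ∀ a, |R.δF (R.s t) a| ≤ R.δ a) :
    R.MemberOn Ts :=
  have h := phaseLock_of_reparam hab hε hψc hψm hD hy hne hxc hxd hrange hs hsd
  { hy := hy
    hsc := h.1
    hsd := h.2.1
    hsD := h.2.2.1
    hlock := h.2.2.2
    hδ := hδ }

variable {R} in
omit [Fintype ι] [Fintype κ] in
/-- **The window's monotonicity from a nowhere-zero phase speed**: if `ẏ_p ≠ 0` on `[a, b] ⊆ D` then
for `ε = 1` or `ε = −1` the function `ε·y_p` is continuous and strictly increasing on `[a, b]` (Rolle: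
a continuous function with nowhere-zero derivative on an interval is injective, hence strictly monotone or
antitone; no continuity of `δF` is needed). This is how layer A′ re-chooses the window as the member
advances: the boxes of `row_sound` keep `ẏ_p(s t)` away from zero. [folklore] -/
theorem strictMonoOn_of_deriv_ne_zero {a b : ℝ} (hab : a ≤ b) (hD : Icc a b ⊆ R.D)
    (hy : ∀ σ ∈ R.D, ∀ i, HasDerivAt (fun r => R.y r i) (R.F (R.y σ) i + R.δF σ i) σ)
    (hne : ∀ σ ∈ Icc a b, R.F (R.y σ) R.p + R.δF σ R.p ≠ 0) :
    ∃ ε : ℝ, (ε = 1 ∨ ε = -1) ∧ ContinuousOn (fun σ => ε * R.y σ R.p) (Icc a b) ∧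
      StrictMonoOn (fun σ => ε * R.y σ R.p) (Icc a b) := by
  have hc : ContinuousOn (fun σ => R.y σ R.p) (Icc a b) := fun σ hσ =>
    (hy σ (hD hσ) R.p).continuousAt.continuousWithinAt
  have hinj : InjOn (fun σ => R.y σ R.p) (Icc a b) := by
    intro σ₁ h₁ σ₂ h₂ h
    by_contra hneq
    rcases lt_or_gt_of_ne hneq with hlt | hlt
    · obtain ⟨c, hc', hcd⟩ := exists_hasDerivAt_eq_zero (f := fun σ => R.y σ R.p)
        (f' := fun σ => R.F (R.y σ) R.p + R.δF σ R.p) hlt (hc.mono (Icc_subset_Icc h₁.1 h₂.2)) h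
        (fun σ hσ => hy σ (hD ⟨h₁.1.trans hσ.1.le, hσ.2.le.trans h₂.2⟩) R.p)
      exact hne c ⟨h₁.1.trans hc'.1.le, hc'.2.le.trans h₂.2⟩ hcd
    · obtain ⟨c, hc', hcd⟩ := exists_hasDerivAt_eq_zero (f := fun σ => R.y σ R.p)
        (f' := fun σ => R.F (R.y σ) R.p + R.δF σ R.p) hlt (hc.mono (Icc_subset_Icc h₂.1 h₁.2))
        h.symm (fun σ hσ => hy σ (hD ⟨h₂.1.trans hσ.1.le, hσ.2.le.trans h₁.2⟩) R.p)
      exact hne c ⟨h₂.1.trans hc'.1.le, hc'.2.le.trans h₁.2⟩ hcd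
  rcases (hc.strictMonoOn_of_injOn_Icc' hab hinj) with hm | hm
  · refine ⟨1, Or.inl rfl, continuousOn_const.mul hc, ?_⟩
    intro σ₁ h₁ σ₂ h₂ hlt
    simp only [one_mul]
    exact hm h₁ h₂ hlt
  · refine ⟨-1, Or.inr rfl, continuousOn_const.mul hc, ?_⟩
    · intro σ₁ h₁ σ₂ h₂ hlt
      simp only [neg_mul, one_mul, neg_lt_neg_iff]
      exact hm h₁ h₂ hlt

end RowModel

/-! ### Specialisation to a row of the chain -/

namespace RowCheck

open Literature.Analysis.FluidPDE.FluidComputer ChainField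

namespace RowData

/-- **A′ for one row**: the member record of `toModel (canon h) G T0 m` on `[T0, Ts]` from the ODE, a
monotonicity window `[a, b] ⊆ m.D` for `ε·y_p`, the range condition `ε·x̂_p(t − T0) ∈ (ε y_p(a), ε y_p(b))`,
the member's `s`/`sd` being the reparametrisation there, and the defect class. The reference is the row's
polynomial `xh r.CQ`, whose continuity and derivative are `hasDerivAt_xh`. [folklore] -/
def memberOn_row {r : RowData} (h : r.framesOK = true) (G : r.GateOK) (T0 : ℝ) (m : MemberData)
    {Ts a b ε : ℝ} (hab : a ≤ b) (hε : ε = 1 ∨ ε = -1)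
    (hψc : ContinuousOn (fun σ => ε * m.y σ r.p) (Icc a b))
    (hψm : StrictMonoOn (fun σ => ε * m.y σ r.p) (Icc a b)) (hD : Icc a b ⊆ m.D)
    (hy : ∀ σ ∈ m.D, ∀ i, HasDerivAt (fun τ => m.y τ i) (F G.g G.Λ (m.y σ) i + m.δF σ i) σ)
    (hne : ∀ σ ∈ Icc a b, F G.g G.Λ (m.y σ) r.p + m.δF σ r.p ≠ 0)
    (hrange : ∀ t ∈ Icc T0 Ts, ε * xh r.CQ (t - T0) r.p ∈ Ioo (ε * m.y a r.p) (ε * m.y b r.p))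
    (hs : ∀ t ∈ Icc T0 Ts, m.s t = Reparam.inv hab hψc hψm (ε * xh r.CQ (t - T0) r.p))
    (hsd : ∀ t ∈ Ico T0 Ts,
      m.sd t = xhd r.CQ (t - T0) r.p / (F G.g G.Λ (m.y (m.s t)) r.p + m.δF (m.s t) r.p))
    (hδ : ∀ t ∈ Icc T0 Ts, (∀ a, |(toModel (canon h) G T0 m).e t a| ≤ r.EbarR a) →
      ∀ a, |m.δF (m.s t) a| ≤ r.δR a) :
    (toModel (canon h) G T0 m).MemberOn Ts := by
  have hxd' : ∀ t : ℝ, HasDerivAt (fun x => xh r.CQ (x - T0) r.p) (xhd r.CQ (t - T0) r.p) t := by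
    intro t
    have h1 := (hasDerivAt_xh r.CQ r.p (t - T0)).comp t ((hasDerivAt_id' t).sub_const T0)
    rw [mul_one] at h1
    exact h1
  exact RowModel.memberOn_of_reparam (R := toModel (canon h) G T0 m) hab hε hψc hψm hD hy hne
    (fun t _ => (hxd' t).continuousAt.continuousWithinAt) (fun t _ => (hxd' t).hasDerivWithinAt)
    hrange hs hsd hδ

end RowData

end RowCheck

end Summit.NavierStokesRegularity.FluidComputer
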